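import Summits.CriticalPhenomena.PercolationContinuityZ3.Theorems.AdditiveGluing.Negative.CertSearch

/-!
# `AdditiveGluing` (crux stmt-CriticalPhenomena-4576, route `PercNearOneGluing`):
# a faster certified per-graph check (`checkDH`: array histogram of block masks)

`checkD` of `CertSearch.lean` recomputes, for every `(o, A)`, a pass over the weighted cluster
labellings of the graph; at seven vertices (`≤ 877` labellings, `128` relay sets) that is the
bottleneck (≈ 1.2 s per dense graph compiled).  `checkDH` computes ONE array histogram of the block
mask of `o` per observer `o` (`histA`), reads `#{o ↔ b}` and `#{o ↔ A}` off it (`bitSum`,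
`disjSum`: `#{o ↔ A} = 2^m − Σ_{T ∩ A = ∅} hist[T]`), and skips the trivially true triples `o ∈ A`
and `o = b`.  Its guarantee `checkDH_spec` has exactly the conclusion of `checkD_spec` (count forms of
the additive gluing inequality and of Kozma–Nitzan's Conjecture 1 for EVERY `(o, b, A ≠ ∅)`, the
skipped triples being discharged by count facts), so `additiveGluing_half_of_counts` /
`knConj1_half_of_counts` apply verbatim.  `checkDH_eq_checkD_five` records (by `native_decide`) that
the two checks agree on all `1024` graphs on `Fin 5`.  Used by `CertIsoSeven.lean`.
Nothing here asserts the crux.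
-/

namespace Summit.CriticalPhenomena.PercolationContinuityZ3.Theorems.AdditiveGluing.Negative.Cert

open MeasureTheory
open Literature.Probability.Percolation Literature.Probability.LatticeModels

/-! ### The fast check (computable) -/

section Checker

/-- Bit mask of the block of `o` (labels held in an array). -/
def blockMaskA (n : ℕ) (s : Array ℕ) (o : ℕ) : ℕ :=
  (List.range n).foldr (fun a m => if (s[a]?).getD 0 = (s[o]?).getD 0 then m ||| 2 ^ a else m) 0

/-- One histogram step: add the weight of a state at the index of its block mask of `o`. -/
def histStep (n o : ℕ) (h : Array ℕ) (t : Array ℕ × ℕ) : Array ℕ :=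
  if hm : blockMaskA n t.1 o < h.size then
    h.set (blockMaskA n t.1 o) (h[blockMaskA n t.1 o] + t.2) hm else h

/-- The histogram of the block mask of `o` over the weighted states (indices `< 2^n`). -/
def histA (n : ℕ) (d : List (Array ℕ × ℕ)) (o : ℕ) : Array ℕ :=
  d.foldl (histStep n o) (Array.replicate (2 ^ n) 0)

/-- `Σ_{T : T ∩ A = ∅} hist[T]` (mass of the states whose block of `o` misses `A`). -/
def disjSum (h : Array ℕ) (Am : ℕ) : ℕ :=
  ((List.range h.size).map fun T => if T &&& Am == 0 then (h[T]?).getD 0 else 0).sum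

/-- `Σ_{T ∋ b} hist[T]` (mass of the states with `o ↔ b`). -/
def bitSum (h : Array ℕ) (b : ℕ) : ℕ :=
  ((List.range h.size).map fun T => if T.testBit b then (h[T]?).getD 0 else 0).sum

/-- The two count inequalities for one `(o, b, A)`: skipped (trivially true) if `A = ∅`-coded,
`o ∈ A`; else some `a ∈ A` with `#{o ↔ A} ≤ #{o ↔ b} + (2^m − #{a ↔ b})` and
`#{o ↔ A} · #{a ↔ b} ≤ #{o ↔ b} · 2^m` (`amArr[A] = #{o ↔ A}`, `colb[a] = #{a ↔ b}`). -/
def checkOB (n N cob : ℕ) (amArr : Array ℕ) (colb : List ℕ) (o Am : ℕ) : Bool :=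
  Am == 0 || Am.testBit o ||
    (List.range n).any fun a => Am.testBit a &&
      (decide ((amArr[Am]?).getD 0 ≤ cob + (N - colb.getD a 0)) &&
        decide ((amArr[Am]?).getD 0 * colb.getD a 0 ≤ cob * N))

/-- THE FAST CHECK for one graph from its labelling distribution (loop order `o → b → A → a`;
triples with `o = b` or `o ∈ A` are skipped: there both inequalities hold trivially). -/
def checkDH (n : ℕ) (d : List (List ℕ × ℕ)) : Bool :=
  let da := d.map fun e => (e.1.toArray, e.2)
  let N := (d.map fun e => e.2).sum
  let hs := (List.range n).map fun o => histA n da o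
  let cm := hs.map fun h => (List.range n).map fun b => bitSum h b
  (List.range n).all fun o =>
    let amArr := ((List.range (2 ^ n)).map fun Am => N - disjSum (hs.getD o #[]) Am).toArray
    (List.range n).all fun b => o == b ||
      (List.range (2 ^ n)).all fun Am =>
        checkOB n N ((cm.getD o []).getD b 0) amArr (cm.map fun row => row.getD b 0) o Am

end Checker

/-! ### Semantics of the histogram -/

/-- Array labels give the same block mask. -/
theorem blockMaskA_toArray (n : ℕ) (s : List ℕ) (o : ℕ) : blockMaskA n s.toArray o = blockMask n s o := by
  unfold blockMaskA blockMask
  simp only [List.getElem?_toArray, ← List.getD_eq_getElem?_getD]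

/-- A block mask has no bits `≥ n`. -/
theorem blockMask_lt (n : ℕ) (s : List ℕ) (o : ℕ) : blockMask n s o < 2 ^ n := by
  unfold blockMask
  suffices h : ∀ l : List ℕ, (∀ a ∈ l, a < n) →
      l.foldr (fun a m => if s.getD a 0 = s.getD o 0 then m ||| 2 ^ a else m) 0 < 2 ^ n from
    h _ fun a ha => List.mem_range.1 ha
  intro l hl
  induction l with
  | nil => exact Nat.two_pow_pos n
  | cons a l ih =>
    rw [List.foldr_cons]
    have ih' := ih fun x hx => hl x (List.mem_cons_of_mem _ hx)
    split_ifs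
    · exact Nat.or_lt_two_pow ih' (Nat.pow_lt_pow_right (by norm_num) (hl a List.mem_cons_self))
    · exact ih'

/-- Size of the histogram. -/
theorem size_histA (n : ℕ) (d : List (Array ℕ × ℕ)) (o : ℕ) : (histA n d o).size = 2 ^ n := by
  unfold histA
  suffices h : ∀ (l : List (Array ℕ × ℕ)) (h₀ : Array ℕ), (l.foldl (histStep n o) h₀).size = h₀.size by
    rw [h, Array.size_replicate]
  intro l
  induction l with
  | nil => intro h₀; rfl
  | cons t l ih =>
    intro h₀
    rw [List.foldl_cons, ih]
    unfold histStep
    split_ifs <;> simp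

/-- Entries of the histogram: the mass of the states with a given block mask. -/
theorem getD_histA (n : ℕ) (d : List (List ℕ × ℕ)) (o T : ℕ) (hT : T < 2 ^ n) :
    ((histA n (d.map fun e => (e.1.toArray, e.2)) o)[T]?).getD 0 = wcntN (fun s => blockMask n s o == T) d := by
  unfold histA
  suffices h : ∀ (l : List (List ℕ × ℕ)) (h₀ : Array ℕ), h₀.size = 2 ^ n →
      (((l.map fun e => (e.1.toArray, e.2)).foldl (histStep n o) h₀)[T]?).getD 0 =
        (h₀[T]?).getD 0 + wcntN (fun s => blockMask n s o == T) l by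
    rw [h _ _ (Array.size_replicate ..), Array.getElem?_replicate, if_pos hT, Option.getD_some, zero_add]
  intro l
  induction l with
  | nil => intro h₀ _; simp [wcntN]
  | cons t l ih =>
    intro h₀ hsz
    have hsz' : (histStep n o h₀ (t.1.toArray, t.2)).size = 2 ^ n := by
      unfold histStep; split_ifs <;> simp [hsz]
    rw [List.map_cons, List.foldl_cons, ih _ hsz', wcntN_cons, ← add_assoc]
    congr 1
    have hm : blockMaskA n t.1.toArray o < h₀.size := by
      rw [blockMaskA_toArray, hsz]; exact blockMask_lt n t.1 o
    unfold histStep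
    rw [dif_pos hm]
    simp only [blockMaskA_toArray]
    by_cases hmt : blockMask n t.1 o = T
    · subst hmt
      rw [Array.getElem?_set_self (by rw [hsz]; exact blockMask_lt n t.1 o)]
      simp only [Option.getD_some, beq_self_eq_true, if_true]
      rw [Array.getElem_eq_getElem?_get, Option.get_eq_getD]
    · rw [Array.getElem?_set_ne (by rw [hsz]; exact blockMask_lt n t.1 o) hmt]
      simp [hmt]

/-- Sum over `List.range` as a `Finset` sum. -/
theorem sum_map_range_eq {f : ℕ → ℕ} : ∀ N : ℕ, ((List.range N).map f).sum = ∑ i ∈ Finset.range N, f i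
  | 0 => by simp
  | N + 1 => by rw [List.range_succ, List.map_append, List.sum_append, sum_map_range_eq N,
      Finset.sum_range_succ]; simp

/-- Fibre counting for the masses: summing the `T`-fibres selected by `Q` gives the `Q`-mass. -/
theorem sum_range_ite_wcntN (n : ℕ) (o : ℕ) (Q : ℕ → Bool) : ∀ d : List (List ℕ × ℕ),
    (∑ T ∈ Finset.range (2 ^ n), if Q T then wcntN (fun s => blockMask n s o == T) d else 0) =
      wcntN (fun s => Q (blockMask n s o)) d
  | [] => by simp [wcntN]
  | t :: d => by
    simp only [wcntN_cons]
    rw [← sum_range_ite_wcntN n o Q d]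
    have hsplit : ∀ T ∈ Finset.range (2 ^ n),
        (if Q T = true then (if (blockMask n t.1 o == T) = true then t.2 else 0) +
            wcntN (fun s => blockMask n s o == T) d else 0) =
        (if blockMask n t.1 o = T then (if Q T = true then t.2 else 0) else 0) +
          (if Q T = true then wcntN (fun s => blockMask n s o == T) d else 0) := by
      intro T _
      by_cases hQ : Q T = true <;> by_cases hb : blockMask n t.1 o = T <;> simp [hQ, hb]
    rw [Finset.sum_congr rfl hsplit, Finset.sum_add_distrib, Finset.sum_ite_eq,
      if_pos (Finset.mem_range.2 (blockMask_lt n t.1 o))]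

/-- **Fibre counting**: a test `Q` of the block mask summed against the histogram is the `Q`-mass of
the states. -/
theorem sum_hist_eq_wcntN (n : ℕ) (d : List (List ℕ × ℕ)) (o : ℕ) (Q : ℕ → Bool) :
    ((List.range (2 ^ n)).map fun T => if Q T then
        ((histA n (d.map fun e => (e.1.toArray, e.2)) o)[T]?).getD 0 else 0).sum =
      wcntN (fun s => Q (blockMask n s o)) d := by
  have hre : ((List.range (2 ^ n)).map fun T => if Q T then
      ((histA n (d.map fun e => (e.1.toArray, e.2)) o)[T]?).getD 0 else 0).sum =
      ((List.range (2 ^ n)).map fun T => if Q T then wcntN (fun s => blockMask n s o == T) d else 0).sum :=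
    congrArg _ (List.map_congr_left fun T hT => by rw [getD_histA n d o T (List.mem_range.1 hT)])
  rw [hre, sum_map_range_eq, sum_range_ite_wcntN]

/-- `disjSum` of the histogram = mass of the states whose block of `o` misses `A`. -/
theorem disjSum_histA (n : ℕ) (d : List (List ℕ × ℕ)) (o Am : ℕ) :
    disjSum (histA n (d.map fun e => (e.1.toArray, e.2)) o) Am =
      wcntN (fun s => blockMask n s o &&& Am == 0) d := by
  rw [disjSum, size_histA]; exact sum_hist_eq_wcntN n d o fun T => T &&& Am == 0

/-- `bitSum` of the histogram = mass of the states with `o ↔ b`. -/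
theorem bitSum_histA (n : ℕ) (d : List (List ℕ × ℕ)) (o b : ℕ) :
    bitSum (histA n (d.map fun e => (e.1.toArray, e.2)) o) b =
      wcntN (fun s => (blockMask n s o).testBit b) d := by
  rw [bitSum, size_histA]; exact sum_hist_eq_wcntN n d o fun T => T.testBit b

/-- Complementary masses add up to the total. -/
theorem wcntN_add_wcntN_not (P : List ℕ → Bool) : ∀ d : List (List ℕ × ℕ),
    wcntN P d + wcntN (fun s => !P s) d = (d.map fun e => e.2).sum
  | [] => by simp [wcntN]
  | t :: d => by
    rw [wcntN_cons, wcntN_cons, List.map_cons, List.sum_cons, ← wcntN_add_wcntN_not P d]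
    cases P t.1 <;> simp <;> ring

/-! ### The masses are the counts of `CertChecker` -/

/-- Mass of `{o ↔ b}` = `cntConn`. -/
theorem wcntN_testBit_eq_cntConn {n : ℕ} (es : List (Fin n × Fin n)) (o b : Fin n) :
    wcntN (fun s => (blockMask n s o).testBit b) (es.foldl (fun d q => stepH d q.1 q.2) [(List.range n, 1)]) =
      cntConn (tables n es) o b := by
  rw [← wcConn_eq_cntConn es o b, wcConn, maskTabs, List.map_map, wcntN]
  exact congrArg _ (List.map_congr_left fun e _ => by simp only [Function.comp_apply, getD_map_range _ _ o.2])

/-- Mass of `{block of o meets A}` = `cntConnSet`. -/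
theorem wcntN_and_eq_cntConnSet {n : ℕ} (es : List (Fin n × Fin n)) (o : Fin n) (Am : ℕ) :
    wcntN (fun s => blockMask n s o &&& Am != 0) (es.foldl (fun d q => stepH d q.1 q.2) [(List.range n, 1)]) =
      cntConnSet (tables n es) o Am := by
  rw [← wcConnSet_eq_cntConnSet es o Am, wcConnSet, maskTabs, List.map_map, wcntN]
  exact congrArg _ (List.map_congr_left fun e _ => by simp only [Function.comp_apply, getD_map_range _ _ o.2])

/-- `#{o ↔ A} = 2^m − (mass of the states whose block of o misses A)`. -/
theorem cntConnSet_eq_sub {n : ℕ} (es : List (Fin n × Fin n)) (o : Fin n) (Am : ℕ) :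
    cntConnSet (tables n es) o Am = 2 ^ es.length -
      wcntN (fun s => blockMask n s o &&& Am == 0) (es.foldl (fun d q => stepH d q.1 q.2) [(List.range n, 1)]) := by
  have h := wcntN_add_wcntN_not (fun s => blockMask n s ↑o &&& Am == 0)
    (es.foldl (fun d q => stepH d q.1 q.2) [(List.range n, 1)])
  rw [sum_map_snd_foldl_stepH] at h
  have h2 : wcntN (fun s => !(blockMask n s ↑o &&& Am == 0))
      (es.foldl (fun d q => stepH d q.1 q.2) [(List.range n, 1)]) = cntConnSet (tables n es) o Am := by
    rw [← wcntN_and_eq_cntConnSet]; rfl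
  omega

/-- Counts are at most `2^m` (point-to-set). -/
theorem cntConnSet_le {n : ℕ} (es : List (Fin n × Fin n)) (o Am : ℕ) : cntConnSet (tables n es) o Am ≤ 2 ^ es.length := by
  rw [← length_tables es]; exact List.countP_le_length

/-- `#{o ↔ o} = 2^m`. -/
theorem cntConn_self {n : ℕ} (es : List (Fin n × Fin n)) (o : Fin n) : cntConn (tables n es) o o = 2 ^ es.length := by
  rw [cntConn, tables, List.countP_map, ← List.length_sublists' es]
  rw [List.countP_eq_length]
  intro ω _
  rw [Function.comp_apply, testBit_reachTable_iff_mem_openConn]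
  exact SimpleGraph.Reachable.refl _

/-! ### What the fast check guarantees -/

/-- **`checkDH` has the guarantee of `checkD`** (count forms of both inequalities for every
`(o, b, A ≠ ∅)`; the skipped triples `o ∈ A`, `o = b` hold by count facts with the relay `a = o`,
resp. any `a ∈ A`). -/
theorem checkDH_spec {n : ℕ} {es : List (Fin n × Fin n)}
    (h : checkDH n (es.foldl (fun d q => stepH d q.1 q.2) [(List.range n, 1)]) = true)
    (o b : Fin n) {Am : ℕ} (hAm : Am < 2 ^ n) (hAm0 : Am ≠ 0) :
    ∃ a : Fin n, Am.testBit a = true ∧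
      cntConnSet (tables n es) o Am ≤ cntConn (tables n es) o b +
        (2 ^ es.length - cntConn (tables n es) a b) ∧
      cntConnSet (tables n es) o Am * cntConn (tables n es) a b ≤ cntConn (tables n es) o b * 2 ^ es.length := by
  have hSle := cntConnSet_le es o Am
  have hCle := cntConn_le es
  -- the trivial triples
  by_cases ho : Am.testBit o = true
  · refine ⟨o, ho, ?_, ?_⟩
    · have := hCle o b; omega
    · exact Nat.mul_le_mul hSle le_rfl |>.trans (by rw [Nat.mul_comm])
  by_cases hob : o = b
  · subst hob
    obtain ⟨i, hi⟩ := Nat.exists_testBit_of_ne_zero hAm0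
    have hin : i < n := by
      by_contra hni
      have : Am < 2 ^ i := lt_of_lt_of_le hAm (Nat.pow_le_pow_right (by norm_num) (not_lt.1 hni))
      rw [Nat.testBit_lt_two_pow this] at hi
      exact Bool.false_ne_true hi
    refine ⟨⟨i, hin⟩, hi, ?_, ?_⟩
    · rw [cntConn_self]; omega
    · rw [cntConn_self]; exact Nat.mul_le_mul hSle (hCle _ _)
  -- the checked triples
  simp only [checkDH, List.all_eq_true, List.mem_range, Bool.or_eq_true, beq_iff_eq] at h
  have h1 := (h o o.2 b b.2).resolve_left (fun h => hob (Fin.ext h)) Am hAm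
  simp only [checkOB, Bool.or_eq_true, beq_iff_eq, List.any_eq_true, List.mem_range, Bool.and_eq_true,
    decide_eq_true_eq] at h1
  obtain ⟨a, ha, hta, hle1, hle2⟩ := h1.resolve_left (not_or.2 ⟨hAm0, ho⟩)
  refine ⟨⟨a, ha⟩, hta, ?_⟩
  simp only [List.map_map, Function.comp_def, getD_map_range _ _ o.2, getD_map_range _ _ b.2,
    getD_map_range _ _ ha, List.getElem?_toArray, List.getElem?_map, List.getElem?_range hAm,
    Option.map_some, Option.getD_some, bitSum_histA, disjSum_histA, sum_map_snd_foldl_stepH] at hle1 hle2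
  rw [wcntN_testBit_eq_cntConn es o b, wcntN_testBit_eq_cntConn es ⟨a, ha⟩ b, ← cntConnSet_eq_sub] at hle1 hle2
  exact ⟨hle1, hle2⟩

/-- `checkDH` agrees with `checkD` on every graph on `Fin 5` (`native_decide`). -/
theorem checkDH_eq_checkD_five : ((allPairs 5).sublists'.all fun es =>
    checkDH 5 (es.foldl (fun d q => stepH d q.1 q.2) [(List.range 5, 1)]) ==
    checkD 5 (es.foldl (fun d q => stepH d q.1 q.2) [(List.range 5, 1)])) = true := by
  native_decide

end Summit.CriticalPhenomena.PercolationContinuityZ3.Theorems.AdditiveGluing.Negative.Cert
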